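import Summits.BirchSwinnertonDyer.BirchSwinnertonDyer.Theorems.SchneiderFreeAdditiveX3Defs
import Summits.BirchSwinnertonDyer.BirchSwinnertonDyer.Theorems.SchneiderFreeAdditiveX3GordTwoBranchIMCReceptacle
import Summits.BirchSwinnertonDyer.Rank1Residual.X11b.EmbeddingDatumPrime
import Literature.FieldTheory.AlgClosed.PadicAlgClEquivComplex
import HarnessLib

/-!
# Route `SchneiderFreeAdditiveX3`, cruxes `GordTwoBranchIMC` (item 19177) and `PotMultBranchIMC`
# (item 19176): the TYPED HALVES close the additive socket — `CTL₀ ∧ H1 ∧ H3 ∧ H2 ⟹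
# AdditiveIMCLowerBDPInputManinAt W p`, hence both cruxes BY NAME from `AnticycControlAdditive`

Cell `bsd-schneider-ideate`, seat `bsd-schneider-door-c3` (prover, gen 2). HONEST FRAMING: pure
bookkeeping over the receptacle of gen 0 (`SchneiderFree.additiveIMCLowerBDPOnTreeLeAt_of_value_of_dvd`,
file `…GordTwoBranchIMCReceptacle.lean`) and the typed halves of
`Theorems/SchneiderFreeAdditiveX3Defs.lean`; NOTHING is asserted about elliptic curves, every result
is CONDITIONAL on its displayed hypotheses, BSD is not proved by any of this, and the cruxes
`GordTwoBranchIMC` / `PotMultBranchIMC` / `AnticycControlAdditive` stay OPEN. `--supports` material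
for item 19177 (and, verbatim, for item 19176: the socket is the same on the (M) cell).

## What is kernel-checked here

* §1 **anti-vacuity of the embedding clause** (`exists_branchInducesPrime`): for an imaginary
  quadratic `K` and ANY prime `𝔭 ∋ p`, some embedding datum `ι' : ℚ̄_p ≃ ℂ` induces `𝔭`
  (`BranchInducesPrime p ι' 𝔭`) — Steinitz (`PadicAlgCl.nonempty_ringEquiv_complex`) and "every
  prime above a split `p` is `𝔭_ι` or `𝔭_{ι∘conj}`" (`X11b.eq_primeOfEmbeddingDatum_or_eq_trans_starRingAut`).
  So the `∃ ι'` in H1 and the `∀ ι'` in H2/H3 range over a non-empty set at every frame of the socket.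
* §2 **pointwise in `(W, p)`** (`additiveIMCLowerBDPInputManinAt_of_halves`): the socket
  `AdditiveIMCLowerBDPInputManinAt W p` (T-B6-1♯ Manin-robust: at every datum and frame,
  `∃ n, HasCharValuationAt … n ∧ 2·ord_p log_{ω_E} P ≤ n + 2·v_p(Dt.c)`) follows from the control
  input `AdditiveControlInputManinAt W p` (CTL₀: the `HasCharValuationAt` witness; crux r4 pointwise)
  and the three typed halves H1 `BranchBDPExistsAt W p` (a frame `(ι', Ω_K, Ω_p, L)` exists,
  CONSUMED), H3 `BranchIMCDivAt W p` (`Ch_Λ(X_ac)·R₀⟦T⟧ ⊆ (L)` at that frame) and H2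
  `BranchBDPValueLeAt W p` (`L(0) = u·(log_{ω_E} P / c)²`, `u ∈ R₀`, at that frame), by the receptacle.
* §3 **class level, BY NAME**: `gordTwoBranchIMC_of_anticycControlAdditive_of_typedHalves`
  (`AnticycControlAdditive ∧ H1 ∧ H2 ∧ H3` on the (G-ord, `e = 2`) cell `⟹ GordTwoBranchIMC`,
  item 19177) and `potMultBranchIMC_of_anticycControlAdditive_of_typedHalves` (the same on the (M) cell
  `⟹ PotMultBranchIMC`, item 19176); and `gordTwo_stub_divisibilityLe_of_typedHalves`: the
  REGISTERED stub `stub_divisibilityLe` of item 19177 (signature verbatim, skeleton e612942f…) from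
  H1 ∧ H2 ∧ H3 on the cell (via gen 0's `gordTwo_stub_divisibilityLe_of_halves`), and its (M) twin
  `potMult_stub_divisibilityLe_of_typedHalves` (item 19176's registered stub; same conclusion as seat
  door-c2's `potMult_stub_divisibilityLe_of_halves`, via gen 0's pointwise `divisibilityLe_of_value_of_dvd`).

Net: modulo the control crux (item 19178), each branch crux IS `H1 ∧ H3 ∧ H2` for Castella-type
frames of the datum's newform with free periods — H3 = Keller–Yin 2410.23241 Thm. 3.5.1 read at the
frame (PREPRINT; (G-ord, `e = 2`) only), H1 = Castella–Hsieh's construction on the `χ_ε`-branch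
(derivation), H2 = the value at 𝟙 against the datum's Heegner point (NOT in print at `p² ∣ N`; see
the docstrings of the Defs file for the located gaps).

References: Keller–Yin, arXiv:2410.23241 Def. 3.4.1, Prop. 3.4.4, Thm. 3.5.1 (pp. 19–20);
Castella–Hsieh, Math. Ann. 370 (2018) Def. 3.5, Prop. 3.6, Thm. 4.8 (arXiv:1505.08165 pp. 10–11,
15); Castella, Camb. J. Math. 6 (2018) Thm. 3.1, §5 (arXiv:1704.06608 pp. 9, 12); Jetchev–Skinner–
Wan, Camb. J. Math. 5 (2017) §7.4.1 (arXiv:1512.06894 p. 30).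
-/

noncomputable section

open scoped Classical

open WeierstrassCurve NumberField IsDedekindDomain Field PowerSeries
  Literature.NumberTheory.EllipticCurves
  Literature.NumberTheory.EllipticCurves.ModularForms
  Literature.NumberTheory.EllipticCurves.GreenbergSelmer
  Literature.NumberTheory.EllipticCurves.Rank1Residual
  Literature.NumberTheory.EllipticCurves.Rank1Residual.Typed
  Summit.BirchSwinnertonDyer.Rank1Residual
  Summit.BirchSwinnertonDyer.Rank1Residual.X11b
  Summit.BirchSwinnertonDyer.Rank1Residual.X11b.AcSelmer
  Summit.BirchSwinnertonDyer.Rank1Residual.X11b.Halves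
  Summit.BirchSwinnertonDyer.BirchSwinnertonDyer.Theses.SchneiderFreeAdditiveX3

-- D-0017 layout: summit = sub-problem, so `Summit.BirchSwinnertonDyer.BirchSwinnertonDyer.…` is the
-- mandated namespace (same option as the route's sockets files).
set_option linter.dupNamespace false

namespace Summit.BirchSwinnertonDyer.BirchSwinnertonDyer.Theorems.SchneiderFree

/-! ## §1 Anti-vacuity of the embedding clause -/

section AntiVacuity

variable (p : ℕ) [Fact p.Prime] {K : Type} [Field K] [NumberField K]

/-- **Every prime `𝔭 ∋ p` of an imaginary quadratic `K` is induced by some embedding datum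
`ι' : ℚ̄_p ≃ ℂ`.** Steinitz gives one `ι` (`PadicAlgCl.nonempty_ringEquiv_complex`); every prime above
`p` is `𝔭_ι` or `𝔭_{ι ∘ conj}` (`X11b.eq_primeOfEmbeddingDatum_or_eq_trans_starRingAut`), and `𝔭_{ι'}`
satisfies the clause for every infinite place (`X11b.forall_mem_primeOfEmbeddingDatum_iff`). So the
`∃ ι'` of H1 and the `∀ ι'` of H2/H3 are never about an empty set. [folklore] -/
theorem exists_branchInducesPrime (hK : IsImaginaryQuadratic K) {𝔭 : HeightOneSpectrum (𝓞 K)}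
    (h𝔭 : ((p : ℕ) : 𝓞 K) ∈ 𝔭.asIdeal) : ∃ ι' : PadicAlgCl p ≃+* ℂ, BranchInducesPrime p ι' 𝔭 := by
  obtain ⟨ι⟩ := PadicAlgCl.nonempty_ringEquiv_complex p
  obtain ⟨w₀⟩ := (inferInstance : Nonempty (InfinitePlace K))
  rcases X11b.eq_primeOfEmbeddingDatum_or_eq_trans_starRingAut p ι hK w₀ h𝔭 with h | h
  · exact ⟨ι, fun w k ↦ by
      rw [h]; exact X11b.forall_mem_primeOfEmbeddingDatum_iff p ι hK w₀ w k⟩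
  · exact ⟨ι.trans (starRingAut : ℂ ≃+* ℂ), fun w k ↦ by
      rw [h]; exact X11b.forall_mem_primeOfEmbeddingDatum_iff p _ hK w₀ w k⟩

end AntiVacuity

/-! ## §2 Pointwise in `(W, p)`: the socket from CTL₀ and the typed halves -/

section Pointwise

variable {W : WeierstrassCurve ℚ} [W.IsElliptic] [W.IsGloballyMinimal] {p : ℕ} [Fact p.Prime]

/-- **The additive socket FROM THE TYPED HALVES (pointwise in `(W, p)`).** The Manin-robust control
input `AdditiveControlInputManinAt W p` (which carries CTL₀: `X_ac^∅(E_K[p^∞])` is `Λ`-torsion with a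
characteristic generator of non-zero constant term at every frame) together with H1
(`BranchBDPExistsAt W p`: a frame `(ι', Ω_K, Ω_p, L)` with `IsBDPLFunction ι' 𝔭 κ γ Dt.f Ω_K Ω_p L`
EXISTS — consumed), H3 (`BranchIMCDivAt W p`: `Ch_Λ(X_ac^∅)·R₀⟦T⟧ ⊆ (L)` for every such frame) and
H2 (`BranchBDPValueLeAt W p`: `L(0) = u·(log_{ω_E} P / c)²`, `u ∈ R₀`, for every such frame) give
the socket `AdditiveIMCLowerBDPInputManinAt W p`, i.e. `2·ord_p log_{ω_E} P ≤ n + 2·v_p(c)` at every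
datum and frame, with the SAME `n` as CTL₀ — through the receptacle
`additiveIMCLowerBDPOnTreeLeAt_of_value_of_dvd`. CONDITIONAL on the four hypotheses; nothing asserted.
[cite: Castella2018, §5 (5.1)–(5.3) (arXiv:1704.06608 p. 12) (the assembly, as an inequality)]
[cite: JetchevSkinnerWan2017, §7.4.1 (arXiv:1512.06894 p. 30)] -/
theorem additiveIMCLowerBDPInputManinAt_of_halves (hC : AdditiveControlInputManinAt W p)
    (h1 : BranchBDPExistsAt W p) (h2 : BranchBDPValueLeAt W p) (h3 : BranchIMCDivAt W p) :
    AdditiveIMCLowerBDPInputManinAt W p := by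
  intro N _ K _ _ Dt H ι P hr hloc hN hK hodd hunit hHe hL hP hnt κ hκ γ _ 𝔭 h𝔭 he hf
  obtain ⟨n, hn⟩ := exists_hasCharValuationAt_of_control
    (hC N K Dt H ι P hr hloc hN hK hodd hunit hHe hL hP hnt κ hκ γ 𝔭 h𝔭 he hf)
  obtain ⟨ι', hι', ΩK, Ωp, L, hΩK, hΩp, hBDP⟩ :=
    h1 N K Dt H ι P hr hloc hN hK hodd hunit hHe hL hP hnt κ hκ γ 𝔭 h𝔭 he hf
  obtain ⟨u, hu⟩ :=
    h2 N K Dt H ι P hr hloc hN hK hodd hunit hHe hL hP hnt κ hκ γ 𝔭 h𝔭 he hf ι' hι' ΩK Ωp L hΩK hΩp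
      hBDP
  have hdiv := h3 N K Dt H ι P hr hloc hN hK hodd hunit hHe hL hP hnt κ hκ γ 𝔭 h𝔭 he hf ι' hι' ΩK Ωp
    L hΩK hΩp hBDP
  exact additiveIMCLowerBDPOnTreeLeAt_of_value_of_dvd hn hdiv u Dt.c hu

end Pointwise

/-! ## §3 Class level: both branch cruxes BY NAME, and the registered divisibility stub of item 19177 -/

/-- **`GordTwoBranchIMC` (item 19177) ⇐ `AnticycControlAdditive` ∧ H1 ∧ H2 ∧ H3 on the (G-ord,
`e = 2`) reducible cell.** The control crux (item 19178; `SubGordTwo ⊆ SubSemistableTwist`) supplies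
CTL₀ at every frame; the typed halves of `SchneiderFreeAdditiveX3Defs.lean` supply the frame, the
divisibility `Ch_Λ(X_ac)·R₀⟦T⟧ ⊆ (L)` (Keller–Yin 2410.23241 Thm. 3.5.1 at the frame, PRE) and the
Manin-robust value at 𝟙; `additiveIMCLowerBDPInputManinAt_of_halves` concludes the socket, i.e. the
crux BY NAME. CONDITIONAL on all four hypotheses; nothing asserted.
[cite: KellerYin2024b, Thm. 3.5.1 (arXiv:2410.23241 p. 20) (shape only; preprint)]
[cite: JetchevSkinnerWan2017, §7.4.1 (arXiv:1512.06894 p. 30)] -/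
theorem gordTwoBranchIMC_of_anticycControlAdditive_of_typedHalves
    (hC : Theses.SchneiderFreeAdditiveX3.AnticycControlAdditive)
    (h1 : ∀ (W : WeierstrassCurve ℚ) [W.IsElliptic] [W.IsGloballyMinimal] (p : ℕ) [Fact p.Prime],
      W.analyticRank = 1 → p ≠ 2 → ClassX3 W p → Additive.SubGordTwo W p → BranchBDPExistsAt W p)
    (h2 : ∀ (W : WeierstrassCurve ℚ) [W.IsElliptic] [W.IsGloballyMinimal] (p : ℕ) [Fact p.Prime],
      W.analyticRank = 1 → p ≠ 2 → ClassX3 W p → Additive.SubGordTwo W p → BranchBDPValueLeAt W p)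
    (h3 : ∀ (W : WeierstrassCurve ℚ) [W.IsElliptic] [W.IsGloballyMinimal] (p : ℕ) [Fact p.Prime],
      W.analyticRank = 1 → p ≠ 2 → ClassX3 W p → Additive.SubGordTwo W p → BranchIMCDivAt W p) :
    Theses.SchneiderFreeAdditiveX3.GordTwoBranchIMC := by
  intro W _ _ p _ hr hp2 hX hS
  have hsst : Additive.SubSemistableTwist W p := Or.inr hS
  exact additiveIMCLowerBDPInputManinAt_of_halves (hC W p hr hp2 hX hsst) (h1 W p hr hp2 hX hS)
    (h2 W p hr hp2 hX hS) (h3 W p hr hp2 hX hS)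

/-- **`PotMultBranchIMC` (item 19176) ⇐ `AnticycControlAdditive` ∧ H1 ∧ H2 ∧ H3 on the (M)
reducible cell** — verbatim the same composition (the socket `AdditiveIMCLowerBDPInputManinAt` is
the same on SubM; `SubM ⊆ SubSemistableTwist`). On (M) no divisibility H3 is in print (Keller–Yin
treat `p ∤ N′` only and name the potentially multiplicative case future work, arXiv:2410.23241
p. 15). CONDITIONAL on all four hypotheses; nothing asserted.
[cite: KellerYin2024b, §3.1 Case II (arXiv:2410.23241 pp. 13–15) (scope statement only)]
[cite: JetchevSkinnerWan2017, §7.4.1 (arXiv:1512.06894 p. 30)] -/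
theorem potMultBranchIMC_of_anticycControlAdditive_of_typedHalves
    (hC : Theses.SchneiderFreeAdditiveX3.AnticycControlAdditive)
    (h1 : ∀ (W : WeierstrassCurve ℚ) [W.IsElliptic] [W.IsGloballyMinimal] (p : ℕ) [Fact p.Prime],
      W.analyticRank = 1 → p ≠ 2 → ClassX3 W p → Additive.SubM W p → BranchBDPExistsAt W p)
    (h2 : ∀ (W : WeierstrassCurve ℚ) [W.IsElliptic] [W.IsGloballyMinimal] (p : ℕ) [Fact p.Prime],
      W.analyticRank = 1 → p ≠ 2 → ClassX3 W p → Additive.SubM W p → BranchBDPValueLeAt W p)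
    (h3 : ∀ (W : WeierstrassCurve ℚ) [W.IsElliptic] [W.IsGloballyMinimal] (p : ℕ) [Fact p.Prime],
      W.analyticRank = 1 → p ≠ 2 → ClassX3 W p → Additive.SubM W p → BranchIMCDivAt W p) :
    Theses.SchneiderFreeAdditiveX3.PotMultBranchIMC := by
  intro W _ _ p _ hr hp2 hX hS
  have hsst : Additive.SubSemistableTwist W p := Or.inl hS
  exact additiveIMCLowerBDPInputManinAt_of_halves (hC W p hr hp2 hX hsst) (h1 W p hr hp2 hX hS)
    (h2 W p hr hp2 hX hS) (h3 W p hr hp2 hX hS)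

/-- **The REGISTERED stub `stub_divisibilityLe` of item 19177 (signature verbatim, skeleton
e612942f…) ⇐ H1 ∧ H2 ∧ H3 on the (G-ord, `e = 2`) cell.** H1 produces the frame `(ι', Ω_K, Ω_p, L)`,
H3 and H2 are read at it, and gen 0's `gordTwo_stub_divisibilityLe_of_halves` (the receptacle
`divisibilityLe_of_value_of_dvd`: every `HasCharValuationAt`-witness `n` then satisfies
`2·ord_p log_{ω_E} P ≤ n + 2·v_p(c)`) concludes. So the registered divisibility stub IS the
conjunction of the typed halves for Castella-type frames of `Dt.f`. CONDITIONAL; nothing asserted.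
[cite: Castella2018, Thm. 2.3 and §5 (5.1) (arXiv:1704.06608 pp. 5, 12) (shape only)] -/
theorem gordTwo_stub_divisibilityLe_of_typedHalves
    (h1 : ∀ (W : WeierstrassCurve ℚ) [W.IsElliptic] [W.IsGloballyMinimal] (p : ℕ) [Fact p.Prime],
      W.analyticRank = 1 → p ≠ 2 → ClassX3 W p → Additive.SubGordTwo W p → BranchBDPExistsAt W p)
    (h2 : ∀ (W : WeierstrassCurve ℚ) [W.IsElliptic] [W.IsGloballyMinimal] (p : ℕ) [Fact p.Prime],
      W.analyticRank = 1 → p ≠ 2 → ClassX3 W p → Additive.SubGordTwo W p → BranchBDPValueLeAt W p)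
    (h3 : ∀ (W : WeierstrassCurve ℚ) [W.IsElliptic] [W.IsGloballyMinimal] (p : ℕ) [Fact p.Prime],
      W.analyticRank = 1 → p ≠ 2 → ClassX3 W p → Additive.SubGordTwo W p → BranchIMCDivAt W p) :
    ∀ (W : WeierstrassCurve ℚ) [W.IsElliptic] [W.IsGloballyMinimal] (p : ℕ) [Fact p.Prime],
      W.analyticRank = 1 → p ≠ 2 → ClassX3 W p → Additive.SubGordTwo W p →
      ∀ (N : ℕ) [NeZero N] (K : Type) [Field K] [NumberField K]
        (Dt : ModularParametrizationData W N) (H : HeegnerDatum N (NumberField.discr K)) (ι : K →+* ℂ)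
        (P : (W.baseChange K).toAffine.Point),
        W.analyticRank = 1 → Additive.N10.Locus W p → W.conductorNorm ℤ = N → IsImaginaryQuadratic K →
        Odd (NumberField.discr K) → ¬ p ∣ Units.torsionOrder K → SatisfiesHeegnerHypothesis N K →
        (W.quadraticTwist (NumberField.discr K : ℚ)).entireLFunction 1 ≠ 0 →
        WeierstrassCurve.Affine.Point.map ι.toRatAlgHom P = heegnerPointComplex Dt H →
        ¬ IsOfFinAddOrder P →
        ∀ (κ : ZpExtension K p), κ.IsAnticyclotomic →
          ∀ (γ : Field.absoluteGaloisGroup K) [Fact (κ.IsTopGenerator γ)]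
            (𝔭 : HeightOneSpectrum (𝓞 K)) (h𝔭 : ((p : ℕ) : 𝓞 K) ∈ 𝔭.asIdeal)
            (he : 𝔭.asIdeal.ramificationIdx (𝓞 ℚ) = 1) (hf : 𝔭.asIdeal.inertiaDeg (𝓞 ℚ) = 1),
            ∀ n : ℕ, XAc.HasCharValuationAt (W.baseChange K) p κ 𝔭 ∅ γ n →
              2 * X11b.padicLogOrd W p (embAt K p 𝔭 h𝔭 he hf) P ≤
                (n : ℤ) + 2 * (padicValNat p Dt.c.natAbs : ℤ) := by
  refine gordTwo_stub_divisibilityLe_of_halves ?_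
  intro W _ _ p _ hr hp2 hX hS N _ K _ _ Dt H ι P hr' hloc hN hK hodd hunit hHe hL hP hnt κ hκ γ _ 𝔭
    h𝔭 he hf
  obtain ⟨ι', hι', ΩK, Ωp, L, hΩK, hΩp, hBDP⟩ :=
    h1 W p hr hp2 hX hS N K Dt H ι P hr' hloc hN hK hodd hunit hHe hL hP hnt κ hκ γ 𝔭 h𝔭 he hf
  obtain ⟨u, hu⟩ :=
    h2 W p hr hp2 hX hS N K Dt H ι P hr' hloc hN hK hodd hunit hHe hL hP hnt κ hκ γ 𝔭 h𝔭 he hf ι'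
      hι' ΩK Ωp L hΩK hΩp hBDP
  exact ⟨L, u, h3 W p hr hp2 hX hS N K Dt H ι P hr' hloc hN hK hodd hunit hHe hL hP hnt κ hκ γ 𝔭 h𝔭
    he hf ι' hι' ΩK Ωp L hΩK hΩp hBDP, hu⟩

/-- **The REGISTERED stub `stub_divisibilityLe` of item 19176 (PotMultBranchIMC, signature verbatim,
skeleton 66f7551f…) ⇐ H1 ∧ H2 ∧ H3 on the (M) cell** — the (M) twin (same statement as seat door-c2's
receptacle `potMult_stub_divisibilityLe_of_halves` concludes, here fed the TYPED halves): H1 produces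
the frame, H3 and H2 are read at it, and gen 0's pointwise `divisibilityLe_of_value_of_dvd` concludes
for every `HasCharValuationAt`-witness `n`. CONDITIONAL; nothing asserted.
[cite: Castella2018, Thm. 2.3 and §5 (5.1) (arXiv:1704.06608 pp. 5, 12) (shape only)] -/
theorem potMult_stub_divisibilityLe_of_typedHalves
    (h1 : ∀ (W : WeierstrassCurve ℚ) [W.IsElliptic] [W.IsGloballyMinimal] (p : ℕ) [Fact p.Prime],
      W.analyticRank = 1 → p ≠ 2 → ClassX3 W p → Additive.SubM W p → BranchBDPExistsAt W p)
    (h2 : ∀ (W : WeierstrassCurve ℚ) [W.IsElliptic] [W.IsGloballyMinimal] (p : ℕ) [Fact p.Prime],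
      W.analyticRank = 1 → p ≠ 2 → ClassX3 W p → Additive.SubM W p → BranchBDPValueLeAt W p)
    (h3 : ∀ (W : WeierstrassCurve ℚ) [W.IsElliptic] [W.IsGloballyMinimal] (p : ℕ) [Fact p.Prime],
      W.analyticRank = 1 → p ≠ 2 → ClassX3 W p → Additive.SubM W p → BranchIMCDivAt W p) :
    ∀ (W : WeierstrassCurve ℚ) [W.IsElliptic] [W.IsGloballyMinimal] (p : ℕ) [Fact p.Prime],
      W.analyticRank = 1 → p ≠ 2 → ClassX3 W p → Additive.SubM W p →
      ∀ (N : ℕ) [NeZero N] (K : Type) [Field K] [NumberField K]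
        (Dt : ModularParametrizationData W N) (H : HeegnerDatum N (NumberField.discr K)) (ι : K →+* ℂ)
        (P : (W.baseChange K).toAffine.Point),
        W.analyticRank = 1 → Additive.N10.Locus W p → W.conductorNorm ℤ = N → IsImaginaryQuadratic K →
        Odd (NumberField.discr K) → ¬ p ∣ Units.torsionOrder K → SatisfiesHeegnerHypothesis N K →
        (W.quadraticTwist (NumberField.discr K : ℚ)).entireLFunction 1 ≠ 0 →
        WeierstrassCurve.Affine.Point.map ι.toRatAlgHom P = heegnerPointComplex Dt H →
        ¬ IsOfFinAddOrder P →
        ∀ (κ : ZpExtension K p), κ.IsAnticyclotomic →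
          ∀ (γ : Field.absoluteGaloisGroup K) [Fact (κ.IsTopGenerator γ)]
            (𝔭 : HeightOneSpectrum (𝓞 K)) (h𝔭 : ((p : ℕ) : 𝓞 K) ∈ 𝔭.asIdeal)
            (he : 𝔭.asIdeal.ramificationIdx (𝓞 ℚ) = 1) (hf : 𝔭.asIdeal.inertiaDeg (𝓞 ℚ) = 1),
            ∀ n : ℕ, XAc.HasCharValuationAt (W.baseChange K) p κ 𝔭 ∅ γ n →
              2 * X11b.padicLogOrd W p (embAt K p 𝔭 h𝔭 he hf) P ≤
                (n : ℤ) + 2 * (padicValNat p Dt.c.natAbs : ℤ) := by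
  intro W _ _ p _ hr hp2 hX hS N _ K _ _ Dt H ι P hr' hloc hN hK hodd hunit hHe hL hP hnt κ hκ γ _ 𝔭
    h𝔭 he hf n hn
  obtain ⟨ι', hι', ΩK, Ωp, L, hΩK, hΩp, hBDP⟩ :=
    h1 W p hr hp2 hX hS N K Dt H ι P hr' hloc hN hK hodd hunit hHe hL hP hnt κ hκ γ 𝔭 h𝔭 he hf
  obtain ⟨u, hu⟩ :=
    h2 W p hr hp2 hX hS N K Dt H ι P hr' hloc hN hK hodd hunit hHe hL hP hnt κ hκ γ 𝔭 h𝔭 he hf ι'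
      hι' ΩK Ωp L hΩK hΩp hBDP
  exact divisibilityLe_of_value_of_dvd hn (h3 W p hr hp2 hX hS N K Dt H ι P hr' hloc hN hK hodd
    hunit hHe hL hP hnt κ hκ γ 𝔭 h𝔭 he hf ι' hι' ΩK Ωp L hΩK hΩp hBDP) u Dt.c hu

/-! ## §4 (append, route rev 6) The same compositions from the REPAIRED control item
`AnticycControlAdditiveK` (item 19295: Kolyvagin → control) and the `kolyvagin` conjunct of `PrintedFacts` -/

/-- **`GordTwoBranchIMC` (item 19177) ⇐ Kolyvagin ∧ `AnticycControlAdditiveK` ∧ H1 ∧ H2 ∧ H3** — the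
rev-6 form of `gordTwoBranchIMC_of_anticycControlAdditive_of_typedHalves`: the route's repaired control
item (19295) is the control equality UNDER the printed fact `kolyvagin` (a conjunct of `PrintedFacts`,
destructured by `closes`), so `AnticycControlAdditiveK` applied to it is the rev-3 `AnticycControlAdditive`.
CONDITIONAL on all five hypotheses; nothing asserted.
[cite: KellerYin2024b, Thm. 3.5.1 (arXiv:2410.23241 p. 20) (shape only; preprint)] [cite: Gross1991, Thm. 1.3] -/
theorem gordTwoBranchIMC_of_anticycControlAdditiveK_of_typedHalves
    (hKo : ∀ (N : ℕ) [NeZero N] (W : WeierstrassCurve ℚ) (K : Type) [Field K] [NumberField K],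
      Literature.NumberTheory.EllipticCurves.kolyvagin N W K)
    (hC : Theses.SchneiderFreeAdditiveX3.AnticycControlAdditiveK)
    (h1 : ∀ (W : WeierstrassCurve ℚ) [W.IsElliptic] [W.IsGloballyMinimal] (p : ℕ) [Fact p.Prime],
      W.analyticRank = 1 → p ≠ 2 → ClassX3 W p → Additive.SubGordTwo W p → BranchBDPExistsAt W p)
    (h2 : ∀ (W : WeierstrassCurve ℚ) [W.IsElliptic] [W.IsGloballyMinimal] (p : ℕ) [Fact p.Prime],
      W.analyticRank = 1 → p ≠ 2 → ClassX3 W p → Additive.SubGordTwo W p → BranchBDPValueLeAt W p)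
    (h3 : ∀ (W : WeierstrassCurve ℚ) [W.IsElliptic] [W.IsGloballyMinimal] (p : ℕ) [Fact p.Prime],
      W.analyticRank = 1 → p ≠ 2 → ClassX3 W p → Additive.SubGordTwo W p → BranchIMCDivAt W p) :
    Theses.SchneiderFreeAdditiveX3.GordTwoBranchIMC :=
  gordTwoBranchIMC_of_anticycControlAdditive_of_typedHalves (hC hKo) h1 h2 h3

/-- **`PotMultBranchIMC` (item 19176) ⇐ Kolyvagin ∧ `AnticycControlAdditiveK` ∧ H1 ∧ H2 ∧ H3** — the
rev-6 form of `potMultBranchIMC_of_anticycControlAdditive_of_typedHalves`. CONDITIONAL; nothing asserted.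
[cite: KellerYin2024b, §3.1 Case II (arXiv:2410.23241 pp. 13–15) (scope statement only)] [cite: Gross1991, Thm. 1.3] -/
theorem potMultBranchIMC_of_anticycControlAdditiveK_of_typedHalves
    (hKo : ∀ (N : ℕ) [NeZero N] (W : WeierstrassCurve ℚ) (K : Type) [Field K] [NumberField K],
      Literature.NumberTheory.EllipticCurves.kolyvagin N W K)
    (hC : Theses.SchneiderFreeAdditiveX3.AnticycControlAdditiveK)
    (h1 : ∀ (W : WeierstrassCurve ℚ) [W.IsElliptic] [W.IsGloballyMinimal] (p : ℕ) [Fact p.Prime],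
      W.analyticRank = 1 → p ≠ 2 → ClassX3 W p → Additive.SubM W p → BranchBDPExistsAt W p)
    (h2 : ∀ (W : WeierstrassCurve ℚ) [W.IsElliptic] [W.IsGloballyMinimal] (p : ℕ) [Fact p.Prime],
      W.analyticRank = 1 → p ≠ 2 → ClassX3 W p → Additive.SubM W p → BranchBDPValueLeAt W p)
    (h3 : ∀ (W : WeierstrassCurve ℚ) [W.IsElliptic] [W.IsGloballyMinimal] (p : ℕ) [Fact p.Prime],
      W.analyticRank = 1 → p ≠ 2 → ClassX3 W p → Additive.SubM W p → BranchIMCDivAt W p) :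
    Theses.SchneiderFreeAdditiveX3.PotMultBranchIMC :=
  potMultBranchIMC_of_anticycControlAdditive_of_typedHalves (hC hKo) h1 h2 h3

end Summit.BirchSwinnertonDyer.BirchSwinnertonDyer.Theorems.SchneiderFree

end
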